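import Mathlib
import Summits.ValiantsHypothesis.ValiantsHypothesis.Theorems.BarrierLeverPartitionMinorsHitByVPProductStates

/-!
# Route BarrierLever — item `PartitionMinorsHitByVP` (stmt-ValiantsHypothesis-19717):
# the ADDITIVE WITNESS, part 1/2 — its Nisan partition matrix in closed form

Helper file (`--supports stmt-ValiantsHypothesis-19717`; cell valiant-natproofs, rung V4, 𝒟-side,
prover seat val-np-p6 gen 3). Definition-free. Closes NO item.

After the refutation of the universal principal-minor witness (TNS, item 19126, 2026-08-27: the rows
of weight `≤ 1` of `f_K` span only `1 + |T|²` dimensions), the 𝒟-side needs witnesses that are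
LAYOUT-DEPENDENT and whose "capacity per column coordinate" is unbounded. With `x_a = X (castAdd h a)`,
`y_c = X (natAdd h c)`, a shift row `ω₀ : Fin h → ℂ` and a weight table `ω : Fin h → Fin h → ℂ`, put

  `F(ω₀, ω) = ∏_c (1 + ω₀ c · y_c) · ∏_a (1 + x_a · ∏_c (1 + ω a c · y_c))`.

* `coeff_squarefree_prod_one_add_C_mul_X` — the coefficient of a square-free monomial `X^d` in ANY
  product of elementary factors `∏_{e ∈ E} (1 + C (u e) · X (v e))` is `∏_{s ∈ supp d} Σ_{e : v e = s} u e`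
  (induction on `E`: every variable of `d` is supplied by exactly one factor).
* **`coeff_additiveWitness`** — for ALL `S, T ⊆ Fin h`:
  `coeff_{x^S y^T} F = ∏_{c ∈ T} (ω₀ c + Σ_{a ∈ S} ω a c)`;
  row `S` of the partition matrix is the rank-one tensor `⊗_c (1, ℓ_c(S))` with ADDITIVE coordinates
  `ℓ_c(S) = ω₀ c + Σ_{a∈S} ω a c`, i.e. the square-free monomials `z^T` evaluated at the point
  `P_S = ω₀ + Σ_{a∈S} ω a ∈ ℂ^h`. One column coordinate takes as many values as the layout has rows
  (product states = 0/1 tables with one nonzero entry per row are the capacity-one special case).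

Part 2 (`…AdditiveDoor`): size, truncation to degree `2h`, and the door. WHAT THIS IS NOT: no claim on
which layouts admit a nonsingular additive table; nothing on crux 14610 or VP vs VNP.
-/

set_option linter.dupNamespace false

namespace Summit.ValiantsHypothesis.ValiantsHypothesis.Theorems.BarrierLever.AdditiveDoor

open Finset MvPolynomial
open Summit.ValiantsHypothesis.ValiantsHypothesis.Theorems.BarrierLever.ProductStateSums
  (castAdd_ne_natAdd partitionExpo_apply_castAdd partitionExpo_apply_natAdd)

noncomputable section

/-! ## 1. Square-free coefficients of products of elementary factors -/

section Elementary

variable {σ R κ : Type*} [CommSemiring R] [DecidableEq σ] [DecidableEq κ]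

/-- Removing `single s 1` from a square-free exponent: values. -/
theorem tsub_single_apply_of_le_one (d : σ →₀ ℕ) (hd : ∀ t, d t ≤ 1) (s : σ) (hs : s ∈ d.support)
    (t : σ) : (d - Finsupp.single s 1 : σ →₀ ℕ) t = if t = s then 0 else d t := by
  rw [Finsupp.tsub_apply, Finsupp.single_apply]
  by_cases hts : t = s
  · subst hts
    have h1 : d t = 1 := le_antisymm (hd t) (Nat.one_le_iff_ne_zero.mpr (Finsupp.mem_support_iff.mp hs))
    simp [h1]
  · rw [if_neg (Ne.symm hts), if_neg hts, Nat.sub_zero]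

/-- Removing `single s 1` from a square-free exponent: support. -/
theorem support_tsub_single_of_le_one (d : σ →₀ ℕ) (hd : ∀ t, d t ≤ 1) (s : σ)
    (hs : s ∈ d.support) : (d - Finsupp.single s 1 : σ →₀ ℕ).support = d.support.erase s := by
  ext t
  rw [Finsupp.mem_support_iff, tsub_single_apply_of_le_one d hd s hs, Finset.mem_erase,
    Finsupp.mem_support_iff]
  by_cases hts : t = s <;> simp [hts]

/-- **Square-free coefficients of a product of elementary factors.** For a square-free exponent `d`
(all values `≤ 1`), the coefficient of `X^d` in `∏_{e ∈ E} (1 + C (u e) · X (v e))` is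
`∏_{s ∈ supp d} Σ_{e ∈ E, v e = s} u e` (choose, for every variable of `d`, the factor supplying it). -/
theorem coeff_squarefree_prod_one_add_C_mul_X (E : Finset κ) (v : κ → σ) (u : κ → R)
    (d : σ →₀ ℕ) (hd : ∀ t, d t ≤ 1) :
    coeff d (∏ e ∈ E, (1 + C (u e) * X (v e)) : MvPolynomial σ R) =
      ∏ s ∈ d.support, ∑ e ∈ E.filter (fun e => v e = s), u e := by
  induction E using Finset.induction_on generalizing d with
  | empty =>
    rw [Finset.prod_empty, ← C_1, coeff_C]
    by_cases h0 : d = 0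
    · subst h0; simp
    · rw [if_neg (Ne.symm h0)]
      obtain ⟨s, hs⟩ := Finsupp.support_nonempty_iff.mpr h0
      rw [Finset.prod_eq_zero hs]
      simp
  | insert e₀ E he₀ ih =>
    rw [Finset.prod_insert he₀]
    have hexp : ((1 + C (u e₀) * X (v e₀)) * ∏ e ∈ E, (1 + C (u e) * X (v e)) :
        MvPolynomial σ R) = (∏ e ∈ E, (1 + C (u e) * X (v e))) +
          C (u e₀) * (X (v e₀) * ∏ e ∈ E, (1 + C (u e) * X (v e))) := by ring
    rw [hexp, coeff_add, coeff_C_mul, coeff_X_mul', ih d hd]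
    by_cases hv : v e₀ ∈ d.support
    · rw [if_pos hv, ih _ (fun t => (tsub_le_self).trans (hd t)),
        support_tsub_single_of_le_one d hd _ hv]
      -- split off the factor at `s = v e₀` on both sides
      have hA : ∏ s ∈ d.support, (∑ e ∈ E.filter (fun e => v e = s), u e) =
          (∑ e ∈ E.filter (fun e => v e = v e₀), u e) *
            ∏ s ∈ d.support.erase (v e₀), ∑ e ∈ E.filter (fun e => v e = s), u e :=
        (Finset.mul_prod_erase _ _ hv).symm
      have hB : ∏ s ∈ d.support, (∑ e ∈ (insert e₀ E).filter (fun e => v e = s), u e) =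
          (u e₀ + ∑ e ∈ E.filter (fun e => v e = v e₀), u e) *
            ∏ s ∈ d.support.erase (v e₀), ∑ e ∈ E.filter (fun e => v e = s), u e := by
        rw [← Finset.mul_prod_erase _ _ hv]
        congr 1
        · rw [Finset.filter_insert, if_pos rfl, Finset.sum_insert]
          simp [Finset.mem_filter, he₀]
        · refine Finset.prod_congr rfl fun s hs => ?_
          rw [Finset.filter_insert, if_neg (Ne.symm (Finset.ne_of_mem_erase hs))]
      rw [hA, hB]
      ring
    · rw [if_neg hv, mul_zero, add_zero]
      refine Finset.prod_congr rfl fun s hs => ?_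
      rw [Finset.filter_insert, if_neg]
      rintro rfl
      exact hv hs

end Elementary

/-! ## 2. The additive witness and its partition coefficients -/

variable {h : ℕ}

/-- The partition exponent `x^S y^T` is square-free. -/
theorem partitionExpo_le_one (S T : Finset (Fin h)) (t : Fin (h + h)) :
    ((∑ a ∈ S, Finsupp.single (Fin.castAdd h a) 1 +
      ∑ c ∈ T, Finsupp.single (Fin.natAdd h c) 1 : Fin (h + h) →₀ ℕ) : Fin (h + h) → ℕ) t ≤ 1 := by
  refine Fin.addCases (fun a => ?_) (fun c => ?_) t
  · rw [partitionExpo_apply_castAdd]; split_ifs <;> simp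
  · rw [partitionExpo_apply_natAdd]; split_ifs <;> simp

/-- The `x`-part `x^{S'}` of the exponent lies below `x^S y^T` only if `S' ⊆ S`. -/
theorem subset_of_xExpo_le (S S' T : Finset (Fin h))
    (hle : (∑ a ∈ S', Finsupp.single (Fin.castAdd h a) 1 : Fin (h + h) →₀ ℕ) ≤
      ∑ a ∈ S, Finsupp.single (Fin.castAdd h a) 1 + ∑ c ∈ T, Finsupp.single (Fin.natAdd h c) 1) :
    S' ⊆ S := by
  intro a ha
  have h1 := Finsupp.le_def.mp hle (Fin.castAdd h a)
  have h2 : ((∑ a ∈ S', Finsupp.single (Fin.castAdd h a) 1 +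
      ∑ c ∈ (∅ : Finset (Fin h)), Finsupp.single (Fin.natAdd h c) 1 : Fin (h + h) →₀ ℕ) :
      Fin (h + h) → ℕ) (Fin.castAdd h a) = if a ∈ S' then 1 else 0 :=
    partitionExpo_apply_castAdd S' ∅ a
  rw [Finset.sum_empty, add_zero] at h2
  rw [h2, if_pos ha, partitionExpo_apply_castAdd] at h1
  by_contra hna
  rw [if_neg hna] at h1
  exact Nat.not_succ_le_zero 0 h1

/-- `∏_{a ∈ S'} x_a` is the monomial of the `x`-part exponent. -/
theorem prod_X_castAdd_eq_monomial (S' : Finset (Fin h)) :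
    (∏ a ∈ S', X (Fin.castAdd h a) : MvPolynomial (Fin (h + h)) ℂ) =
      monomial (∑ a ∈ S', Finsupp.single (Fin.castAdd h a) 1) 1 := by
  rw [monomial_sum_one]
  rfl

/-- Expansion of the `x`-read-once product: `∏_a (1 + x_a g_a) = Σ_{S'} x^{S'} ∏_{a∈S'} g_a`. -/
theorem prod_one_add_X_mul (g : Fin h → MvPolynomial (Fin (h + h)) ℂ) :
    (∏ a, (1 + X (Fin.castAdd h a) * g a)) =
      ∑ S' ∈ (Finset.univ : Finset (Fin h)).powerset,
        monomial (∑ a ∈ S', Finsupp.single (Fin.castAdd h a) 1) (1 : ℂ) * ∏ a ∈ S', g a := by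
  rw [Finset.prod_one_add]
  refine Finset.sum_congr rfl fun S' _ => ?_
  rw [Finset.prod_mul_distrib, prod_X_castAdd_eq_monomial]

/-- The `y`-part attached to `x^{S'}` is a product of elementary factors indexed by
`(insertNone S') × Fin h` (the shift row is the index `none`). -/
theorem yPart_eq_prod_elementary (ω₀ : Fin h → ℂ) (ω : Fin h → Fin h → ℂ) (S' : Finset (Fin h)) :
    ((∏ c : Fin h, (1 + C (ω₀ c) * X (Fin.natAdd h c))) *
        ∏ a ∈ S', ∏ c : Fin h, (1 + C (ω a c) * X (Fin.natAdd h c)) :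
        MvPolynomial (Fin (h + h)) ℂ) =
      ∏ e ∈ (Finset.insertNone S') ×ˢ (Finset.univ : Finset (Fin h)),
        (1 + C (Option.elim e.1 (ω₀ e.2) (fun a => ω a e.2)) * X (Fin.natAdd h e.2)) := by
  rw [Finset.prod_product, Finset.prod_insertNone]
  rfl

/-- **Partition coefficients of the additive witness.** For all `S, T ⊆ Fin h`:
`coeff_{x^S y^T} (∏_c (1 + ω₀ c y_c) · ∏_a (1 + x_a ∏_c (1 + ω a c y_c))) = ∏_{c∈T} (ω₀ c + Σ_{a∈S} ω a c)`. -/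
theorem coeff_additiveWitness (ω₀ : Fin h → ℂ) (ω : Fin h → Fin h → ℂ) (S T : Finset (Fin h)) :
    coeff (∑ a ∈ S, Finsupp.single (Fin.castAdd h a) 1 + ∑ c ∈ T, Finsupp.single (Fin.natAdd h c) 1)
      ((∏ c : Fin h, (1 + C (ω₀ c) * X (Fin.natAdd h c))) *
        ∏ a : Fin h, (1 + X (Fin.castAdd h a) * ∏ c : Fin h, (1 + C (ω a c) * X (Fin.natAdd h c))) :
        MvPolynomial (Fin (h + h)) ℂ) =
      ∏ c ∈ T, (ω₀ c + ∑ a ∈ S, ω a c) := by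
  classical
  set d := (∑ a ∈ S, Finsupp.single (Fin.castAdd h a) 1 +
    ∑ c ∈ T, Finsupp.single (Fin.natAdd h c) 1 : Fin (h + h) →₀ ℕ) with hd_def
  have hd1 : ∀ t, d t ≤ 1 := partitionExpo_le_one S T
  rw [prod_one_add_X_mul, Finset.mul_sum, coeff_sum]
  simp_rw [mul_left_comm _ (monomial _ (1 : ℂ)) _, coeff_monomial_mul', one_mul]
  rw [Finset.sum_eq_single_of_mem S (Finset.mem_powerset.mpr (Finset.subset_univ S))]
  · -- the main term `S' = S`
    have hle : (∑ a ∈ S, Finsupp.single (Fin.castAdd h a) 1 : Fin (h + h) →₀ ℕ) ≤ d :=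
      le_self_add
    rw [if_pos hle, hd_def, add_tsub_cancel_left, yPart_eq_prod_elementary,
      coeff_squarefree_prod_one_add_C_mul_X _ _ _ _ (by
        intro t
        have := partitionExpo_le_one (h := h) ∅ T t
        rwa [Finset.sum_empty, zero_add] at this)]
    -- support of `y^T` is `T.map natAdd`
    have hsupp : (∑ c ∈ T, Finsupp.single (Fin.natAdd h c) 1 : Fin (h + h) →₀ ℕ).support =
        T.map (Fin.natAddEmb h) := by
      ext t
      rw [Finsupp.mem_support_iff, Finset.mem_map]
      have happ := fun t => (show ((∑ a ∈ (∅ : Finset (Fin h)), Finsupp.single (Fin.castAdd h a) 1 +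
          ∑ c ∈ T, Finsupp.single (Fin.natAdd h c) 1 : Fin (h + h) →₀ ℕ) : Fin (h + h) → ℕ) t =
          ((∑ c ∈ T, Finsupp.single (Fin.natAdd h c) 1 : Fin (h + h) →₀ ℕ) : Fin (h + h) → ℕ) t
        by rw [Finset.sum_empty, zero_add])
      refine Fin.addCases (fun a => ?_) (fun c => ?_) t
      · rw [← happ, partitionExpo_apply_castAdd]
        simp only [Finset.notMem_empty, if_false, ne_eq, not_true_eq_false, false_iff,
          not_exists, not_and]
        intro c _ hc
        exact castAdd_ne_natAdd a c hc.symm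
      · rw [← happ, partitionExpo_apply_natAdd]
        constructor
        · intro hc
          refine ⟨c, ?_, rfl⟩
          by_contra hcT
          rw [if_neg hcT] at hc
          exact hc rfl
        · rintro ⟨c', hc', hcc'⟩
          have : c' = c := Fin.natAdd_inj _ |>.mp hcc'  -- `natAddEmb` coerces to `natAdd`
          subst this
          rw [if_pos hc']
          exact one_ne_zero
    rw [hsupp, Finset.prod_map]
    refine Finset.prod_congr rfl fun c _ => ?_
    -- the edges supplying `y_c` are `(i, c)`, `i ∈ insertNone S`
    rw [Finset.sum_filter, Finset.sum_product, Finset.sum_insertNone]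
    have hinner : ∀ i : Option (Fin h), (∑ c' : Fin h,
        if Fin.natAdd h ((i, c').2) = (Fin.natAddEmb h) c then
          Option.elim (i, c').1 (ω₀ (i, c').2) (fun a => ω a (i, c').2) else 0) =
        Option.elim i (ω₀ c) (fun a => ω a c) := by
      intro i
      simp only [Fin.natAddEmb_apply, Fin.natAdd_inj]
      rw [Finset.sum_ite_eq' Finset.univ c]
      simp
    simp_rw [hinner]
    rfl
  · -- the other terms vanish
    intro S' _ hS'
    split_ifs with hle
    · have hsub : S' ⊆ S := subset_of_xExpo_le S S' T hle
      obtain ⟨a, haS, haS'⟩ : ∃ a ∈ S, a ∉ S' := by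
        by_contra hcon
        push Not at hcon
        exact hS' (Finset.Subset.antisymm hsub hcon)
      rw [yPart_eq_prod_elementary,
        coeff_squarefree_prod_one_add_C_mul_X _ _ _ _ (fun t => (tsub_le_self).trans (hd1 t))]
      have hmem : Fin.castAdd h a ∈
          (d - ∑ a ∈ S', Finsupp.single (Fin.castAdd h a) 1 : Fin (h + h) →₀ ℕ).support := by
        rw [Finsupp.mem_support_iff, Finsupp.tsub_apply, hd_def, partitionExpo_apply_castAdd,
          if_pos haS]
        have h2 : ((∑ a ∈ S', Finsupp.single (Fin.castAdd h a) 1 +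
            ∑ c ∈ (∅ : Finset (Fin h)), Finsupp.single (Fin.natAdd h c) 1 : Fin (h + h) →₀ ℕ) :
            Fin (h + h) → ℕ) (Fin.castAdd h a) = if a ∈ S' then 1 else 0 :=
          partitionExpo_apply_castAdd S' ∅ a
        rw [Finset.sum_empty, add_zero] at h2
        rw [h2, if_neg haS']
        exact one_ne_zero
      refine Finset.prod_eq_zero hmem ?_
      refine Finset.sum_eq_zero fun e he => ?_
      exfalso
      rw [Finset.mem_filter] at he
      exact castAdd_ne_natAdd a e.2 he.2.symm
    · rfl

end

end Summit.ValiantsHypothesis.ValiantsHypothesis.Theorems.BarrierLever.AdditiveDoor
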